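import Summits.CriticalPhenomena.CardyFormulaZ2.Theorems.CardyMagicRigidityNestingRigidityNeckNecklaceT
import HarnessLib

/-!
# Crux `NestingRigidity`, line `pinch-resampling` (v4), stub S11: node and arm certificates of a necklace on `𝕋`

Crux `Summit.CriticalPhenomena.CardyFormulaZ2.Theses.CardyMagicRigidity.NestingRigidity` (stmt-CriticalPhenomena-4835),
line `pinch-resampling` v4, stub S11 `stub_neckHookupCoarseT : NeckHookupCoarseT`.  Worker W6c, wave 6: the site-`𝕋` twin of
`…NeckZ2NecklaceCertificates` (worker W6a), sequel of `…NeckNecklaceT` (normal form `TNecklace η ℓ lam s x`): the two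
deterministic certificates consumed by the glued bound `real_tFourArm_and_armsIn_le` (`…NeckNodeReimerRegionT`) in the
summation of `TNodeAbsBoundChainA` (amended plan of worker W6a, module docstring of `…GapEntropy`).

* §1 **Node certificate** (`TNecklace.exists_first_run_lt`, `TNecklace.exists_node_crossings`, registered anchor
  `tNecklace_node_certificate`): if the annulus
  `tAnn w r R` (`r ≤ R ≤ s - 1`, `|w - x|_𝕋 ≤ s + 1`) isolates an index set `Q` (locales of `Q` with
  `|p i - w|_𝕋 + 2ℓ + 1 < r`, the others with `R + 2ℓ + 1 ≤ |p i - w|_𝕋`; the closeness radius of the normal form is `2ℓ + 1`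
  on `𝕋`), then for the FIRST RUN `[i₁, j₁]` of `Q` the clusters of `u i₁` and `u (j₁ + 1)` contain crossings `p₁ → q₁`,
  `p₂ → q₂` of the annulus, not joined inside it.
* §2 **Arm certificate**: `TNecklace.bigIdx i ∈ [i, i + 1]` (`bigIdx_spec`; the cluster through the locale `p i`), `path_u_bigIdx`,
  `exists_far_point` / `arm_hypothesis` (for `2R' ≤ lam` the locale is joined inside `Λ_{2s}(x)` to `𝕋`-distance `≥ R'`
  from any centre), `not_path_p_of_bigIdx_ne` (cluster exemption), `not_path_p_p` (distinct big clusters).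
-/

noncomputable section

namespace Summit.CriticalPhenomena.CardyFormulaZ2.Cruxes.NestingRigidity.PinchResampling

open MeasureTheory Set Literature.Probability.Percolation Literature.Probability.LatticeModels

namespace TNecklace

variable {η : SiteConfig (Site 2)} {ℓ lam s : ℕ} {x : Site 2} (N : TNecklace η ℓ lam s x)

/-! ## §1 The node certificate -/

/-- **First run of a set of indices** (generic over the number of indices `k`): if some index `< k` lies in `Q`, there
is a run `[i₁, j₁] ⊆ Q`, `j₁ < k`, with no index of `Q` before `i₁` and `j₁ + 1 ∉ Q` (or `j₁ + 1 = k`). -/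
theorem exists_first_run_lt (k : ℕ) {Q : ℕ → Prop} (hQ : ∃ i < k, Q i) :
    ∃ i₁ j₁, i₁ ≤ j₁ ∧ j₁ < k ∧ (∀ i, i₁ ≤ i → i ≤ j₁ → Q i) ∧ (∀ i < i₁, ¬ Q i) ∧ (j₁ + 1 < k → ¬ Q (j₁ + 1)) := by
  classical
  -- adapted from `Necklace.exists_first_run` (`…NeckZ2NecklaceCertificates`), with the number of hops explicit
  have hex : ∃ i, i < k ∧ Q i := by
    obtain ⟨i, hi, hQi⟩ := hQ
    exact ⟨i, hi, hQi⟩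
  set i₁ := Nat.find hex with hi₁
  obtain ⟨hi₁k, hQi₁⟩ := Nat.find_spec hex
  have hmin : ∀ i < i₁, ¬ Q i := fun i hi hQi ↦ Nat.find_min hex hi ⟨hi.trans hi₁k, hQi⟩
  have hex' : ∃ j, i₁ ≤ j ∧ (j + 1 < k → ¬ Q (j + 1)) := ⟨k - 1, by omega, fun h ↦ by omega⟩
  set j₁ := Nat.find hex' with hj₁
  obtain ⟨hij, hend⟩ := Nat.find_spec hex'
  have hrun : ∀ j, i₁ ≤ j → j < j₁ → j + 1 < k ∧ Q (j + 1) := fun j hj hjj ↦ by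
    have h := Nat.find_min hex' hjj
    by_contra hcon
    exact h ⟨hj, fun hlt hQ ↦ hcon ⟨hlt, hQ⟩⟩
  have hj₁k : j₁ < k := by
    by_contra hcon
    have h := hrun (k - 1) (by omega) (by omega)
    omega
  refine ⟨i₁, j₁, hij, hj₁k, fun i hi hij' ↦ ?_, hmin, hend⟩
  rcases hi.eq_or_lt with rfl | hlt
  · exact hQi₁
  · obtain ⟨i, rfl⟩ : ∃ i', i = i' + 1 := ⟨i - 1, by omega⟩
    exact (hrun i (by omega) (by omega)).2

/-- The hexagonal annulus of outer radius `R ≤ s - 1` around a point within `s + 1` of the centre lies in `Λ_{2s}(x)`. -/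
theorem tAnn_subset_tBall_of_le {w : Site 2} (hw : triNorm (w - x) ≤ s + 1) {r R : ℕ} (hRs : R + 1 ≤ s) :
    tAnn w r R ⊆ tBall x (2 * s) := by
  intro z hz
  have h2 := triNorm_sub_le_triNorm_sub_add z w x
  have h3 := hz.2
  change triNorm (z - x) ≤ (2 * s : ℕ)
  push_cast
  omega

/-- **Node certificate**: an annulus `tAnn w r R` isolating the locales of `Q` from the other locales carries two open
crossings in the clusters of `u i₁` and `u (j₁ + 1)`, `[i₁, j₁]` the first run of `Q`, not joined inside the annulus. -/
theorem exists_node_crossings {Q : ℕ → Prop} (hQ : ∃ i < N.k, Q i) {w : Site 2} {r R : ℕ} (hrR : r ≤ R)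
    (hRs : R + 1 ≤ s) (hw : triNorm (w - x) ≤ s + 1)
    (hin : ∀ i < N.k, Q i → triNorm (N.p i - w) + (2 * ℓ + 1) < r)
    (hout : ∀ i < N.k, ¬ Q i → (R : ℤ) + (2 * ℓ + 1) ≤ triNorm (N.p i - w)) :
    ∃ i₁ j₁ p₁ q₁ p₂ q₂, i₁ ≤ j₁ ∧ j₁ < N.k ∧ (∀ i, i₁ ≤ i → i ≤ j₁ → Q i) ∧ (∀ i < i₁, ¬ Q i) ∧
      (j₁ + 1 < N.k → ¬ Q (j₁ + 1)) ∧
      triNorm (p₁ - w) = r ∧ triNorm (q₁ - w) = R ∧ triNorm (p₂ - w) = r ∧ triNorm (q₂ - w) = R ∧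
      PathIn (tColourGraph η true) (tAnn w r R) p₁ q₁ ∧ PathIn (tColourGraph η true) (tAnn w r R) p₂ q₂ ∧
      ¬ PathIn (tColourGraph η true) (tAnn w r R) p₁ p₂ ∧
      PathIn (tColourGraph η true) (tBall x (2 * s)) (N.u i₁) p₁ ∧
      PathIn (tColourGraph η true) (tBall x (2 * s)) (N.u (j₁ + 1)) p₂ := by
  -- adapted from `Necklace.exists_node_crossings` (`…NeckZ2NecklaceCertificates`)
  obtain ⟨i₁, j₁, hij, hj₁k, hrun, hmin, hend⟩ := exists_first_run_lt N.k hQ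
  set S := tBall x (2 * s) with hSdef
  have hAnnS : tAnn w r R ⊆ S := tAnn_subset_tBall_of_le hw hRs
  have hi₁k : i₁ < N.k := by omega
  have hfar : ∀ y, (2 * s : ℤ) ≤ triNorm (y - x) → (R : ℤ) ≤ triNorm (y - w) := fun y hy ↦ by
    have h := triNorm_sub_le_triNorm_sub_add y w x
    omega
  have houtball : ∀ i < N.k, ¬ Q i → ∀ y, triNorm (y - N.p i) ≤ 2 * ℓ + 1 → (R : ℤ) ≤ triNorm (y - w) := by
    intro i hi hQi y hy
    have h := hout i hi hQi
    have h1 := triNorm_sub_le_triNorm_sub_add (N.p i) y w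
    have h2 : triNorm (N.p i - y) = triNorm (y - N.p i) := by rw [← triNorm_neg, neg_sub]
    omega
  have hinball : ∀ i < N.k, Q i → ∀ y, triNorm (y - N.p i) ≤ 2 * ℓ + 1 → triNorm (y - w) < r := by
    intro i hi hQi y hy
    have h := hin i hi hQi
    have h1 := triNorm_sub_le_triNorm_sub_add y (N.p i) w
    omega
  have hU : ∃ q, (R : ℤ) ≤ triNorm (q - w) ∧ PathIn (tColourGraph η true) S (N.inn i₁) q := by
    rcases Nat.eq_zero_or_pos i₁ with hz | hpos
    · obtain ⟨y, hy, hp⟩ := N.u_zero_far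
      refine ⟨y, hfar y hy, ?_⟩
      have h := N.path_u_inn hi₁k
      rw [hz] at h ⊢
      exact h.symm.trans hp
    · obtain ⟨i, rfl⟩ : ∃ i, i₁ = i + 1 := ⟨i₁ - 1, by omega⟩
      refine ⟨N.u (i + 1), ?_, (N.path_u_inn hi₁k).symm⟩
      simp only [TNecklace.u]
      exact houtball i (by omega) (hmin i (by omega)) _ (N.out_near i (by omega))
  have hV : ∃ q, (R : ℤ) ≤ triNorm (q - w) ∧ PathIn (tColourGraph η true) S (N.out j₁) q := by
    by_cases hlast : j₁ + 1 < N.k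
    · refine ⟨N.inn (j₁ + 1), houtball (j₁ + 1) hlast (hend hlast) _ (N.inn_near _ hlast), ?_⟩
      have h := N.path_u_inn hlast
      simpa only [TNecklace.u] using h
    · obtain ⟨y, hy, hp⟩ := N.u_last_far
      have hk : N.k = j₁ + 1 := by omega
      rw [hk] at hp
      simp only [TNecklace.u] at hp
      exact ⟨y, hfar y hy, hp⟩
  obtain ⟨qU, hqU, hpU⟩ := hU
  obtain ⟨qV, hqV, hpV⟩ := hV
  have hinnU : triNorm (N.inn i₁ - w) < r := hinball i₁ hi₁k (hrun i₁ le_rfl hij) _ (N.inn_near i₁ hi₁k)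
  have houtV : triNorm (N.out j₁ - w) < r := hinball j₁ hj₁k (hrun j₁ hij le_rfl) _ (N.out_near j₁ hj₁k)
  obtain ⟨p₁, q₁, hp₁, hq₁, hc₁, hcp₁⟩ := exists_crossing_of_pathIn hrR hinnU hqU hpU
  obtain ⟨p₂, q₂, hp₂, hq₂, hc₂, hcp₂⟩ := exists_crossing_of_pathIn hrR houtV hqV hpV
  have hu₁ : PathIn (tColourGraph η true) S (N.u i₁) p₁ := (N.path_u_inn hi₁k).trans hcp₁
  have hu₂ : PathIn (tColourGraph η true) S (N.u (j₁ + 1)) p₂ := by simpa only [TNecklace.u] using hcp₂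
  refine ⟨i₁, j₁, p₁, q₁, p₂, q₂, hij, hj₁k, hrun, hmin, hend, hp₁, hq₁, hp₂, hq₂, hc₁.mono inter_subset_right,
    hc₂.mono inter_subset_right, fun h ↦ ?_, hu₁, hu₂⟩
  exact N.not_path_u_u (show i₁ < j₁ + 1 by omega) (by omega) ((hu₁.trans (h.mono hAnnS)).trans hu₂.symm)

/-! ## §2 The arm certificate -/

/-- **Index of the big cluster through the locale `p i`**: `i` if `p i = inn i` (the cluster of `u i`), else `i + 1` (the
cluster of `u (i + 1) = out i`). -/
def bigIdx (i : ℕ) : ℕ := by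
  classical
  exact if N.p i = N.inn i then i else i + 1

/-- `i ≤ bigIdx i ≤ i + 1` (so `bigIdx` is at most two-to-one and `bigIdx i ≤ k` for `i < k`). -/
theorem bigIdx_spec (i : ℕ) : i ≤ N.bigIdx i ∧ N.bigIdx i ≤ i + 1 := by
  unfold bigIdx
  split_ifs <;> omega

/-- **The locale `p i` lies in the cluster of `u (bigIdx i)`.** -/
theorem path_u_bigIdx {i : ℕ} (hi : i < N.k) :
    PathIn (tColourGraph η true) (tBall x (2 * s)) (N.u (N.bigIdx i)) (N.p i) := by
  unfold bigIdx
  split_ifs with h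
  · rw [h]
    exact N.path_u_inn hi
  · rcases N.p_eq i hi with h' | h'
    · exact absurd h' h
    · simp only [TNecklace.u]
      rw [← h']
      exact PathIn.refl (N.p_mem i hi).1.1

/-- **Arm certificate**: for every centre `c` and `2 R' ≤ lam`, the locale `p i` is joined inside `Λ_{2s}(x)` to a point at
`𝕋`-distance `≥ R'` from `c` (one of the two ends of its big cluster). -/
theorem exists_far_point {i : ℕ} (hi : i < N.k) (c : Site 2) {R' : ℕ} (hR' : 2 * R' ≤ lam) :
    ∃ q, (R' : ℤ) ≤ triNorm (q - c) ∧ PathIn (tColourGraph η true) (tBall x (2 * s)) (N.p i) q := by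
  obtain ⟨w, w', hd, hw, hw'⟩ := N.big i hi
  have h1 := triNorm_sub_le_triNorm_sub_add w c w'
  have h2 : triNorm (c - w') = triNorm (w' - c) := by rw [← triNorm_neg, neg_sub]
  by_cases hwc : (R' : ℤ) ≤ triNorm (w - c)
  · exact ⟨w, hwc, hw⟩
  · refine ⟨w', ?_, hw'⟩
    have : (2 * R' : ℤ) ≤ lam := by exact_mod_cast hR'
    omega

/-- **Arm hypothesis of the glue**: for an annulus `tAnn c r' R'` with `|p i - c|_𝕋 < r'` and `2 R' ≤ lam`, the locale `p i`
starts an arm inside `Λ_{2s}(x)`. -/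
theorem arm_hypothesis {i : ℕ} (hi : i < N.k) {c : Site 2} {r' R' : ℕ} (hc : triNorm (N.p i - c) < r')
    (hR' : 2 * R' ≤ lam) :
    triNorm (N.p i - c) < r' ∧ ∃ q, (R' : ℤ) ≤ triNorm (q - c) ∧
      PathIn (tColourGraph η true) (tBall x (2 * s)) (N.p i) q :=
  ⟨hc, N.exists_far_point hi c hR'⟩

/-- **Cluster exemption of an arm from a node**: if the big cluster of `p i` is neither the cluster of `u a` nor that of
`u a'`, then `p i` is joined inside `Λ_{2s}(x)` to no point of these two clusters. -/
theorem not_path_p_of_bigIdx_ne {i a a' : ℕ} (hi : i < N.k) (ha : a ≤ N.k) (ha' : a' ≤ N.k) (hne : N.bigIdx i ≠ a)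
    (hne' : N.bigIdx i ≠ a') {p₁ p₂ : Site 2} (hp₁ : PathIn (tColourGraph η true) (tBall x (2 * s)) (N.u a) p₁)
    (hp₂ : PathIn (tColourGraph η true) (tBall x (2 * s)) (N.u a') p₂) :
    ¬ PathIn (tColourGraph η true) (tBall x (2 * s)) (N.p i) p₁ ∧
      ¬ PathIn (tColourGraph η true) (tBall x (2 * s)) (N.p i) p₂ :=
  ⟨fun h ↦ N.not_path_u_u' hne (by have := (N.bigIdx_spec i).2; omega) ha (((N.path_u_bigIdx hi).trans h).trans hp₁.symm),
    fun h ↦ N.not_path_u_u' hne' (by have := (N.bigIdx_spec i).2; omega) ha' (((N.path_u_bigIdx hi).trans h).trans hp₂.symm)⟩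

/-- **Distinct big clusters give arms separated by cluster**: if `bigIdx i ≠ bigIdx j` then `p i ≁ p j` inside
`Λ_{2s}(x)`. -/
theorem not_path_p_p {i j : ℕ} (hi : i < N.k) (hj : j < N.k) (hne : N.bigIdx i ≠ N.bigIdx j) :
    ¬ PathIn (tColourGraph η true) (tBall x (2 * s)) (N.p i) (N.p j) := fun h ↦
  N.not_path_u_u' hne (by have := (N.bigIdx_spec i).2; omega) (by have := (N.bigIdx_spec j).2; omega)
    (((N.path_u_bigIdx hi).trans h).trans (N.path_u_bigIdx hj).symm)

end TNecklace

/-- **Node certificate of a necklace on `𝕋` (registered helper, anchor of this module on the crux item)**: an annulus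
`tAnn w r R` (`r ≤ R ≤ s - 1`, `|w - x|_𝕋 ≤ s + 1`) keeping the locales of a nonempty index set `Q` at `𝕋`-distance
`< r - 2ℓ - 1` from `w` and the others at `≥ R + 2ℓ + 1` carries two open crossings, in the clusters of `u i₁` and `u (j₁ + 1)`
for the first run `[i₁, j₁]` of `Q`, not joined inside the annulus (`TNecklace.exists_node_crossings`). -/
theorem tNecklace_node_certificate : ∀ (ℓ lam s : ℕ) (x : Site 2) (η : SiteConfig (Site 2)) (N : TNecklace η ℓ lam s x) (Q : ℕ → Prop) (w : Site 2) (r R : ℕ), (∃ i < N.k, Q i) → r ≤ R → R + 1 ≤ s → triNorm (w - x) ≤ s + 1 → (∀ i < N.k, Q i → triNorm (N.p i - w) + (2 * ℓ + 1) < r) → (∀ i < N.k, ¬ Q i → (R : ℤ) + (2 * ℓ + 1) ≤ triNorm (N.p i - w)) → ∃ i₁ j₁ p₁ q₁ p₂ q₂, i₁ ≤ j₁ ∧ j₁ < N.k ∧ (∀ i, i₁ ≤ i → i ≤ j₁ → Q i) ∧ (∀ i < i₁, ¬ Q i) ∧ (j₁ + 1 < N.k → ¬ Q (j₁ + 1))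 ∧ triNorm (p₁ - w) = r ∧ triNorm (q₁ - w) = R ∧ triNorm (p₂ - w) = r ∧ triNorm (q₂ - w) = R ∧ PathIn (tColourGraph η true) (tAnn w r R) p₁ q₁ ∧ PathIn (tColourGraph η true) (tAnn w r R) p₂ q₂ ∧ ¬ PathIn (tColourGraph η true) (tAnn w r R) p₁ p₂ ∧ PathIn (tColourGraph η true) (tBall x (2 * s)) (N.u i₁) p₁ ∧ PathIn (tColourGraph η true) (tBall x (2 * s)) (N.u (j₁ + 1)) p₂ :=
  fun _ _ _ _ _ N _ _ _ _ hQ hrR hRs hw hin hout ↦ N.exists_node_crossings hQ hrR hRs hw hin hout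

end Summit.CriticalPhenomena.CardyFormulaZ2.Cruxes.NestingRigidity.PinchResampling

end
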